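import Literature.NumberTheory.Automorphic.UnitaryGroupHyperbolicSwap      -- ★ `hermForm` algebra, `lineSwapGL` (the hyperbolic swap), `hermForm_sub_sub_of_hyperbolic`
import Mathlib.LinearAlgebra.Matrix.SchurComplement                     -- `det (1 + col u * row v) = 1 + v ⬝ᵥ u`
import HarnessLib

/-!
# Crux `H413`, programme P2, N3 road (b) — GENERIC TOOLS (D1)∕(D2′) of ROAD NOTE v2: the GRAPH LAGRANGIAN `Δ′ = (Y ⊕ 0) ⊕ {(x, x) : x ∈ Y^⊥}`
# of the doubled hermitian space `𝔻 = V ⊕ (−V)` and the hyperbolic swap `(y*, y*) ↔ (y, 0)` carrying `Δ = {(x, x)}` onto it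

Cell hodgecm-mathlib (D-0151), FLOOR 0, crux H413 = stmt-HodgeConjecture-24833; K1 lead B-p18 (g28), N3 ROAD NOTE v2
(`F0/P2/B-p18/g28/N3-ROAD.v2.B-p18g28.md` §2 (D1), (D2′)).  THEOREMS ONLY, generic over a commutative ring `S` with `σ : S →+* S` and a Gram matrix
`G : Matrix n n S`; the doubled Gram matrix is `fromBlocks G 0 0 (−G)` on `n ⊕ n` (the tree's ★ `gramD` is its `reindex e₂ e₂`).  Nothing printed is asserted;
no `Cruxes/…/Lines` import; kernel lane `--supports stmt-HodgeConjecture-24833 --as helper`.  HC_CM is proved only modulo the printed citations until rung 0 closes.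

WHY (ROAD v2 §2): the torus weight `μ_v(α)‖α‖^{1/2}` of the N3 letter (b) is read off Kudla's `P_Δ`-normalisation of the DOUBLED CM splitting (★
`parabolicNorm_apply_zero` ∕ ★ `localSplittingDatumCM_parabolic`) after conjugating the diagonal Lagrangian `Δ` to `Δ′`, which — unlike `Δ` — is stabilised by
`m(α) ⊕ 1` for the Levi element `m(α) = d(α, 1, ᾱ⁻¹)` of `P(ℓ) ⊂ U(V)`.  This file supplies the form algebra: (§1) the doubled pairing on `Sum.elim` vectors;
(§2) `Δ′`-type vectors `(x + a, x)` (`a ∈ Y`, `x ∈ Y^⊥`) are pairwise isotropic, and `(g ⊕ 1)` preserves that shape when `g y = α y`, `g x − x ∈ Y`; (§3) the pair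
`e = (y*, y*)`, `f = (y, 0)` is HYPERBOLIC in `𝔻` for a hyperbolic pair `(y, y*)` of `V` (`h(e − f, e − f) = −2`), and the tree's swap ★ `lineSwapGL` along `e − f`
sends every diagonal vector `(x, x)` to the `Δ′`-type vector `(x − h(y,x)•y* + h(y,x)•y, x − h(y,x)•y*)` whose second component is `⊥ y`;
(§4) (D2) generic transport of a `(P, c)`-eigenfunctional of a representation along a conjugation `P ↦ gPg⁻¹` (`λ ↦ λ ∘ ω(g)⁻¹`);
(§5, ED. 2) (D3c) a functional on `A ⊗ B` killing first-factor relations sees a first-factor quotient scalar; (§6, ED. 3) (D1″) the `Δ`-block of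
`w₀ (g ⊕ 1) w₀` is `D = 1 + y* ⊗ φ`, `φ(x) = s(x) + h(y,x)(α − 1)`, `φ(y*) = α − 1`, `det D = α`.

## References
* [Dieudonne1971GroupesClassiques] J. Dieudonné, *La géométrie des groupes classiques* (1971): Chap. II §4–§5 (quasi-reflections, hyperbolic planes).
* [Kudla1994] S. Kudla, *Splitting metaplectic covers of dual reductive pairs*, Israel J. Math. 87 (1994): §2 (the doubled space `V ⊕ (−V)`, `Δ`), Thm. 3.1.
* [HarrisKudlaSweet1996] M. Harris, S. Kudla, W. J. Sweet, J. AMS 9 (1996): §1 (1.11)–(1.16).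
-/

set_option autoImplicit false
-- the mandated namespace has the single-problem summit's repeated segment (`HodgeConjecture.HodgeConjecture`)
set_option linter.dupNamespace false

noncomputable section

open Matrix
open Literature.NumberTheory.Automorphic Literature.NumberTheory.Automorphic.UnitaryGroup

namespace Summit.HodgeConjecture.HodgeConjecture.Cruxes.H413.F0P2oDoubledGraphLagrangian

variable {S : Type*} [CommRing S] (σ : S →+* S) {n : Type*} [Fintype n] [DecidableEq n] (G : Matrix n n S)

/-! ## §1 The doubled pairing `h_𝔻((a, b), (a′, b′)) = h(a, a′) − h(b, b′)` -/

omit [DecidableEq n] in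
/-- **the doubled hermitian pairing on `Sum.elim` vectors**: `h_𝔻((a,b),(a′,b′)) = h(a,a′) − h(b,b′)` for `G^𝔻 = G ⊕ (−G)`.
[cite: Kudla1994, §2] -/
theorem hermForm_doubled (a b a' b' : n → S) :
    hermForm σ (Matrix.fromBlocks G 0 0 (-G)) (Sum.elim a b) (Sum.elim a' b') = hermForm σ G a a' - hermForm σ G b b' := by
  simp only [hermForm_apply, Sum.comp_elim, Matrix.fromBlocks_mulVec, Sum.elim_comp_inl, Sum.elim_comp_inr, Matrix.zero_mulVec,
    add_zero, zero_add, Matrix.neg_mulVec, sumElim_dotProduct_sumElim, dotProduct_neg, sub_eq_add_neg]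

omit [DecidableEq n] in
/-- the DIAGONAL `Δ = {(x, x)}` is totally isotropic: `h_𝔻((x,x),(x′,x′)) = 0`. [cite: Kudla1994, §2] -/
theorem hermForm_doubled_diag (x x' : n → S) :
    hermForm σ (Matrix.fromBlocks G 0 0 (-G)) (Sum.elim x x) (Sum.elim x' x') = 0 := by
  rw [hermForm_doubled, sub_self]

/-! ## §2 The graph Lagrangian `Δ′`: vectors `(x + a, x)` with `a, a′ ∈ Y`, `x, x′ ∈ Y^⊥` -/

/-- **the `Δ′` pairing formula**: `h_𝔻((x + a, x), (x′ + a′, x′)) = h(a, x′) + h(x, a′) + h(a, a′)`. [cite: Kudla1994, §2] -/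
theorem hermForm_doubled_graph (x a x' a' : n → S) :
    hermForm σ (Matrix.fromBlocks G 0 0 (-G)) (Sum.elim (x + a) x) (Sum.elim (x' + a') x') =
      hermForm σ G a x' + hermForm σ G x a' + hermForm σ G a a' := by
  rw [hermForm_doubled, hermForm_add_left, hermForm_add_right, hermForm_add_right]; ring

/-- **`Δ′` is totally isotropic**: if `a ⊥ x′`, `x ⊥ a′`, `a ⊥ a′` (e.g. `a, a′` in an isotropic line `Y` and `x, x′ ∈ Y^⊥`) then
`h_𝔻((x + a, x), (x′ + a′, x′)) = 0`. [cite: Kudla1994, §2] -/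
theorem hermForm_doubled_graph_eq_zero {x a x' a' : n → S} (hax : hermForm σ G a x' = 0) (hxa : hermForm σ G x a' = 0)
    (haa : hermForm σ G a a' = 0) :
    hermForm σ (Matrix.fromBlocks G 0 0 (-G)) (Sum.elim (x + a) x) (Sum.elim (x' + a') x') = 0 := by
  rw [hermForm_doubled_graph, hax, hxa, haa, add_zero, add_zero]

/-- the line case: `a = t • y`, `a′ = t′ • y` with `y` isotropic and `y ⊥ x′`, `x ⊥ y`. [cite: Kudla1994, §2] -/
theorem hermForm_doubled_graph_line_eq_zero {y x x' : n → S} (hyy : hermForm σ G y y = 0) (hyx : hermForm σ G y x' = 0)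
    (hxy : hermForm σ G x y = 0) (t t' : S) :
    hermForm σ (Matrix.fromBlocks G 0 0 (-G)) (Sum.elim (x + t • y) x) (Sum.elim (x' + t' • y) x') = 0 := by
  refine hermForm_doubled_graph_eq_zero σ G ?_ ?_ ?_
  · rw [hermForm_smul_left_eq, hyx, mul_zero]
  · rw [hermForm_smul_right, hxy, mul_zero]
  · rw [hermForm_smul_left_eq, hermForm_smul_right, hyy, mul_zero, mul_zero]

/-- **`g ⊕ 1` on doubled vectors**: `(g ⊕ 1)(a, b) = (g a, b)`. [cite: Kudla1994, §2] -/
theorem fromBlocks_one_mulVec_sumElim (g : Matrix n n S) (a b : n → S) :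
    Matrix.fromBlocks g 0 0 (1 : Matrix n n S) *ᵥ Sum.elim a b = Sum.elim (g *ᵥ a) b := by
  simp only [Matrix.fromBlocks_mulVec, Sum.elim_comp_inl, Sum.elim_comp_inr, Matrix.zero_mulVec, add_zero, zero_add, Matrix.one_mulVec]

/-- **`g ⊕ 1` preserves the `Δ′` shape** when `g y = α y` and `g x − x ∈ Y`: `(g ⊕ 1)(x + t•y, x) = (x + (s + t α)•y, x)` for `g x = x + s•y`.
(For the Levi element `m(α) = d(α,1,ᾱ⁻¹)` of `P(ℓ)`: `s = 0` on `x ∈ V₁`, and the unipotent radical has `α = 1`.) [cite: Kudla1994, §2, Thm. 3.1] -/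
theorem fromBlocks_one_mulVec_graph {g : Matrix n n S} {y x : n → S} {α s : S} (hgy : g *ᵥ y = α • y) (hgx : g *ᵥ x = x + s • y) (t : S) :
    Matrix.fromBlocks g 0 0 (1 : Matrix n n S) *ᵥ Sum.elim (x + t • y) x = Sum.elim (x + (s + t * α) • y) x := by
  rw [fromBlocks_one_mulVec_sumElim, Matrix.mulVec_add, Matrix.mulVec_smul, hgy, hgx, add_smul, smul_smul, add_assoc]

/-! ## §3 The hyperbolic pair `e = (y*, y*)`, `f = (y, 0)` of `𝔻` and the swap `Δ → Δ′` -/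

section Swap

variable {y ys : n → S}

omit [DecidableEq n] in
/-- `e = (y*, y*)` is isotropic in `𝔻` (for ANY `y*`). [cite: Dieudonne1971GroupesClassiques, Chap. II §5] -/
theorem hermForm_doubled_ee (ys : n → S) : hermForm σ (Matrix.fromBlocks G 0 0 (-G)) (Sum.elim ys ys) (Sum.elim ys ys) = 0 :=
  hermForm_doubled_diag σ G ys ys

/-- `f = (y, 0)` is isotropic in `𝔻` iff `y` is: `h_𝔻(f, f) = h(y, y)`. [cite: Dieudonne1971GroupesClassiques, Chap. II §5] -/
theorem hermForm_doubled_ff (y : n → S) : hermForm σ (Matrix.fromBlocks G 0 0 (-G)) (Sum.elim y 0) (Sum.elim y 0) = hermForm σ G y y := by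
  rw [hermForm_doubled, hermForm_zero_left, sub_zero]

/-- `h_𝔻(e, f) = h(y*, y)`. [cite: Dieudonne1971GroupesClassiques, Chap. II §5] -/
theorem hermForm_doubled_ef (y ys : n → S) : hermForm σ (Matrix.fromBlocks G 0 0 (-G)) (Sum.elim ys ys) (Sum.elim y 0) = hermForm σ G ys y := by
  rw [hermForm_doubled, hermForm_zero_right, sub_zero]

/-- `h_𝔻(f, e) = h(y, y*)`. [cite: Dieudonne1971GroupesClassiques, Chap. II §5] -/
theorem hermForm_doubled_fe (y ys : n → S) : hermForm σ (Matrix.fromBlocks G 0 0 (-G)) (Sum.elim y 0) (Sum.elim ys ys) = hermForm σ G y ys := by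
  rw [hermForm_doubled, hermForm_zero_left, sub_zero]

/-- **`(e, f)` is a hyperbolic pair of `𝔻`** when `(y, y*)` is one of `V` (`h(y,y) = 0`, `h(y*,y) = h(y,y*) = 1`; `y*` need NOT be isotropic):
`h_𝔻(e − f, e − f) = −2` — the hypothesis of ★ `lineSwapGL`. [cite: Dieudonne1971GroupesClassiques, Chap. II §5] -/
theorem hermForm_doubled_swapVector (hyy : hermForm σ G y y = 0) (hsy : hermForm σ G ys y = 1) (hys : hermForm σ G y ys = 1) :
    hermForm σ (Matrix.fromBlocks G 0 0 (-G)) (Sum.elim ys ys - Sum.elim y 0) (Sum.elim ys ys - Sum.elim y 0) = -2 :=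
  hermForm_sub_sub_of_hyperbolic σ _ (hermForm_doubled_ee σ G ys) (by rw [hermForm_doubled_ff, hyy])
    (by rw [hermForm_doubled_ef, hsy]) (by rw [hermForm_doubled_fe, hys])

/-- the pairing of the swap vector `e − f = (y* − y, y*)` with a diagonal vector: `h_𝔻(e − f, (x, x)) = −h(y, x)`.
[cite: Dieudonne1971GroupesClassiques, Chap. II §5] -/
theorem hermForm_doubled_swapVector_diag (x : n → S) :
    hermForm σ (Matrix.fromBlocks G 0 0 (-G)) (Sum.elim ys ys - Sum.elim y 0) (Sum.elim x x) = -hermForm σ G y x := by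
  rw [hermForm_sub_left, hermForm_doubled, hermForm_doubled, hermForm_zero_left, sub_self, sub_zero, zero_sub]

/-- the second component of `w₀ (x, x)` is `⊥ y` (so it lies in `Y^⊥`) when `h(y, y*) = 1`: `h(y, x − h(y,x)•y*) = 0`.
[cite: Dieudonne1971GroupesClassiques, Chap. II §5] -/
theorem hermForm_snd_lineSwap_diag_eq_zero (hys : hermForm σ G y ys = 1) (x : n → S) :
    hermForm σ G y (x - hermForm σ G y x • ys) = 0 := by
  rw [hermForm_sub_right, hermForm_smul_right, hys, mul_one, sub_self]

/-- **THE SWAP CARRIES `Δ` INTO `Δ′`**: for the hyperbolic swap `w₀` of ★ `lineSwapGL` along `e − f`,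
`w₀ (x, x) = (x − h(y,x)•y* + h(y,x)•y, x − h(y,x)•y*)` — a `Δ′`-type vector `(x′ + a, x′)` with `x′ = x − h(y,x)•y*`, `a = h(y,x)•y ∈ Y`.
[cite: Dieudonne1971GroupesClassiques, Chap. II §5] [cite: Kudla1994, §2] -/
theorem lineSwapGL_mulVec_diag (h2 : hermForm σ (Matrix.fromBlocks G 0 0 (-G)) (Sum.elim ys ys - Sum.elim y 0) (Sum.elim ys ys - Sum.elim y 0) = -2)
    (x : n → S) :
    ((lineSwapGL σ (Matrix.fromBlocks G 0 0 (-G)) h2 : GL (n ⊕ n) S) : Matrix (n ⊕ n) (n ⊕ n) S) *ᵥ Sum.elim x x =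
      Sum.elim ((x - hermForm σ G y x • ys) + hermForm σ G y x • y) (x - hermForm σ G y x • ys) := by
  rw [lineSwapGL_mulVec, hermForm_doubled_swapVector_diag]
  funext i
  rcases i with i | i
  · simp only [Pi.add_apply, Pi.smul_apply, Pi.sub_apply, Sum.elim_inl, smul_eq_mul]; ring
  · simp only [Pi.add_apply, Pi.smul_apply, Pi.sub_apply, Sum.elim_inr, Pi.zero_apply, smul_eq_mul]; ring

/-- the swap FIXES the diagonal vectors `(x, x)` with `x ⊥ y` (the part `Δ ∩ Δ′`). [cite: Dieudonne1971GroupesClassiques, Chap. II §5] -/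
theorem lineSwapGL_mulVec_diag_of_orth
    (h2 : hermForm σ (Matrix.fromBlocks G 0 0 (-G)) (Sum.elim ys ys - Sum.elim y 0) (Sum.elim ys ys - Sum.elim y 0) = -2)
    {x : n → S} (hyx : hermForm σ G y x = 0) :
    ((lineSwapGL σ (Matrix.fromBlocks G 0 0 (-G)) h2 : GL (n ⊕ n) S) : Matrix (n ⊕ n) (n ⊕ n) S) *ᵥ Sum.elim x x = Sum.elim x x := by
  rw [lineSwapGL_mulVec, hermForm_doubled_swapVector_diag, hyx, neg_zero, zero_smul, add_zero]

/-- the swap sends `e = (y*, y*)` to `f = (y, 0)` (★ `lineSwapGL_mulVec_left` in the doubled space). [cite: Dieudonne1971GroupesClassiques, Chap. II §5] -/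
theorem lineSwapGL_mulVec_ee (hyy : hermForm σ G y y = 0) (hsy : hermForm σ G ys y = 1) (hys : hermForm σ G y ys = 1) :
    ((lineSwapGL σ (Matrix.fromBlocks G 0 0 (-G)) (hermForm_doubled_swapVector σ G hyy hsy hys) : GL (n ⊕ n) S) :
        Matrix (n ⊕ n) (n ⊕ n) S) *ᵥ Sum.elim ys ys = Sum.elim y 0 :=
  lineSwapGL_mulVec_left σ _ _ (hermForm_doubled_ee σ G ys) (by rw [hermForm_doubled_fe, hys])

end Swap

/-! ## §4 (D2) Transport of a parabolic eigenfunctional along a conjugation (generic representation theory) -/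

section Transport

variable {k : Type*} [CommRing k] {Γ : Type*} [Group Γ] {V : Type*} [AddCommGroup V] [Module k V]

/-- **(D2) TRANSPORT**: if `λ` is a `(P, c)`-eigenfunctional of `ω` (`λ(ω(p)v) = c(p)·λ(v)` for `p ∈ P`), then `λ′ := λ ∘ ω(g)⁻¹` is an eigenfunctional for the
CONJUGATE `g P g⁻¹` with the transported scalar: `λ′(ω(p′)v) = c(g⁻¹p′g)·λ′(v)` whenever `g⁻¹ p′ g ∈ P`.  (Use: `ω = ω^𝔻_v`, `P = P_Δ(F_v)`, `λ = ev₀ ∘ r(δ′)`,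
`c = μ(det_Δ)‖det_Δ‖^{1/2}` from ★ `localSplittingDatumCM_parabolic`, `g = w₀` the swap of §3: the `Δ′`-coinvariant functional is a `(P_{Δ′}, c ∘ Ad(w₀⁻¹))`-eigenfunctional.)
[cite: Kudla1994, Thm. 3.1] -/
theorem eigenfunctional_conj (ω : Representation k Γ V) (lam : V →ₗ[k] k) (P : Set Γ) (c : Γ → k)
    (hlam : ∀ p ∈ P, ∀ v, lam (ω p v) = c p * lam v) (g p' : Γ) (hp' : g⁻¹ * p' * g ∈ P) (v : V) :
    (lam ∘ₗ ω g⁻¹) (ω p' v) = c (g⁻¹ * p' * g) * (lam ∘ₗ ω g⁻¹) v := by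
  have hω : ω g⁻¹ (ω p' v) = ω (g⁻¹ * p' * g) (ω g⁻¹ v) := by
    rw [map_mul, map_mul, Module.End.mul_apply, Module.End.mul_apply, ← Module.End.mul_apply (ω g), ← map_mul,
      mul_inv_cancel, map_one, Module.End.one_apply]
  rw [LinearMap.comp_apply, LinearMap.comp_apply, hω, hlam _ hp']

/-- the same with the conjugate written as `p′ = g p g⁻¹`, `p ∈ P`: `λ′(ω(g p g⁻¹) v) = c(p)·λ′(v)`. [cite: Kudla1994, Thm. 3.1] -/
theorem eigenfunctional_conj' (ω : Representation k Γ V) (lam : V →ₗ[k] k) (P : Set Γ) (c : Γ → k)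
    (hlam : ∀ p ∈ P, ∀ v, lam (ω p v) = c p * lam v) (g p : Γ) (hp : p ∈ P) (v : V) :
    (lam ∘ₗ ω g⁻¹) (ω (g * p * g⁻¹) v) = c p * (lam ∘ₗ ω g⁻¹) v := by
  have h := eigenfunctional_conj ω lam P c hlam g (g * p * g⁻¹) (by rwa [← mul_assoc, ← mul_assoc, inv_mul_cancel, one_mul, inv_mul_cancel_right]) v
  rwa [show g⁻¹ * (g * p * g⁻¹) * g = p by rw [← mul_assoc, ← mul_assoc, inv_mul_cancel, one_mul, inv_mul_cancel_right]] at h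

end Transport

/-! ## §5 (D3c) A functional on `A ⊗ B` that kills the first-factor relations sees a first-factor quotient scalar (ED. 2, generic linear algebra) -/

section QuotientScalar

open scoped TensorProduct

variable {k : Type*} [CommRing k] {A B : Type*} [AddCommGroup A] [Module k A] [AddCommGroup B] [Module k B]

/-- **(D3c)**: let `K ≤ A` (the relations of a quotient `A ↠ A⧸K`, e.g. the `Y`-coinvariant relations of the first Schrödinger factor), `T : A → A` acting on `A⧸K` by
the scalar `c` (`T a − c•a ∈ K`), and `λ : A ⊗ B → k` a functional killing `K ⊗ B` on pure tensors.  Then `λ((T a) ⊗ b) = c · λ(a ⊗ b)`.  (Use: `A ⊗ B = 𝒮 ⊗ 𝒮⁻ ≅ 𝒮(𝕎^𝔻-model)`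
via ★ `sumEquivSB`∕`boxSB`, `K` = the `Y ⊗ W`-relations, `T = ω(s_v m(α))`, `c = c(α)` from Schur ★ p831043, `λ = λ′ ∘ sumEquivSB` the `Δ′ ⊗ W`-coinvariant functional.)
[cite: Kudla1994, Thm. 3.1] -/
theorem functional_tmul_eq_smul_of_quotient_scalar (K : Submodule k A) (T : A →ₗ[k] A) (c : k) (hT : ∀ a, T a - c • a ∈ K)
    (lam : A ⊗[k] B →ₗ[k] k) (hlam : ∀ a ∈ K, ∀ b : B, lam (a ⊗ₜ b) = 0) (a : A) (b : B) :
    lam (T a ⊗ₜ b) = c * lam (a ⊗ₜ b) := by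
  have h := hlam _ (hT a) b
  rw [TensorProduct.sub_tmul, map_sub, sub_eq_zero, ← TensorProduct.smul_tmul', map_smul, smul_eq_mul] at h
  exact h

/-- the same for a functional given on a model `M ≃ A ⊗ B` (e.g. ★ `sumEquivSB : 𝒮 ⊗ 𝒮 ≃ 𝒮(F^{ι₁ ⊕ ι₂})`, pure tensors = ★ `boxSB`). [cite: Kudla1994, Thm. 3.1] -/
theorem functional_equiv_tmul_eq_smul_of_quotient_scalar {M : Type*} [AddCommGroup M] [Module k M] (e : A ⊗[k] B ≃ₗ[k] M)
    (K : Submodule k A) (T : A →ₗ[k] A) (c : k) (hT : ∀ a, T a - c • a ∈ K)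
    (lam : M →ₗ[k] k) (hlam : ∀ a ∈ K, ∀ b : B, lam (e (a ⊗ₜ b)) = 0) (a : A) (b : B) :
    lam (e (T a ⊗ₜ b)) = c * lam (e (a ⊗ₜ b)) :=
  functional_tmul_eq_smul_of_quotient_scalar K T c hT (lam ∘ₗ (e : A ⊗[k] B →ₗ[k] M))
    (fun a ha b => by simpa only [LinearMap.comp_apply, LinearEquiv.coe_coe] using hlam a ha b) a b

end QuotientScalar

/-! ## §6 (D1″) The `Δ`-block of `w₀ (g ⊕ 1) w₀`: `x ↦ x + (s(x) + h(y,x)(α − 1)) • y*` (ED. 3) -/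

section DeltaBlock

variable {y ys : n → S}

/-- the swap on a `Δ′`-type vector `(b + t•y, b)` with `b ⊥ y`: `w₀ (b + t•y, b) = (b + t•y*, b + t•y*) ∈ Δ` (`h(y,y) = 0`, `h(y*,y) = 1`).
[cite: Dieudonne1971GroupesClassiques, Chap. II §5] -/
theorem lineSwapGL_mulVec_graph
    (h2 : hermForm σ (Matrix.fromBlocks G 0 0 (-G)) (Sum.elim ys ys - Sum.elim y 0) (Sum.elim ys ys - Sum.elim y 0) = -2)
    (hyy : hermForm σ G y y = 0) (hsy : hermForm σ G ys y = 1) {b : n → S} (hyb : hermForm σ G y b = 0) (t : S) :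
    ((lineSwapGL σ (Matrix.fromBlocks G 0 0 (-G)) h2 : GL (n ⊕ n) S) : Matrix (n ⊕ n) (n ⊕ n) S) *ᵥ Sum.elim (b + t • y) b =
      Sum.elim (b + t • ys) (b + t • ys) := by
  have hc : hermForm σ (Matrix.fromBlocks G 0 0 (-G)) (Sum.elim ys ys - Sum.elim y 0) (Sum.elim (b + t • y) b) = t := by
    rw [hermForm_sub_left, hermForm_doubled, hermForm_doubled, hermForm_zero_left, sub_zero, hermForm_add_right, hermForm_add_right,
      hermForm_smul_right, hermForm_smul_right, hsy, hyb, hyy]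
    ring
  rw [lineSwapGL_mulVec, hc]
  funext i
  rcases i with i | i
  · simp only [Pi.add_apply, Pi.smul_apply, Pi.sub_apply, Sum.elim_inl, smul_eq_mul]; ring
  · simp only [Pi.add_apply, Pi.smul_apply, Pi.sub_apply, Sum.elim_inr, Pi.zero_apply, smul_eq_mul]; ring

/-- **(D1″) THE `Δ`-BLOCK OF `p = w₀ (g ⊕ 1) w₀`** (`w₀` the swap, an involution): for `g` with `g y = α y` and `g b − b = s(x) • y` on `b = b(x) := x − h(y,x)•y* ∈ Y^⊥`
(the Levi element `m(α)` of `P(ℓ)`, `s = 0`; or `N(ℓ)`, `α = 1`), `p (x, x) = (D x, D x)` with **`D x = x + (s(x) + h(y,x)(α − 1)) • y*`** — so `p ∈ P_Δ` with `Δ`-block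
`D = 1 + y* ⊗ φ`, `φ(y*) = α − 1`, `det D = α`. [cite: Kudla1994, §2, Thm. 3.1] [cite: Dieudonne1971GroupesClassiques, Chap. II §5] -/
theorem swap_conj_blockOne_mulVec_diag
    (h2 : hermForm σ (Matrix.fromBlocks G 0 0 (-G)) (Sum.elim ys ys - Sum.elim y 0) (Sum.elim ys ys - Sum.elim y 0) = -2)
    (hyy : hermForm σ G y y = 0) (hsy : hermForm σ G ys y = 1) (hys : hermForm σ G y ys = 1)
    {g : Matrix n n S} {α : S} (hgy : g *ᵥ y = α • y) (s : (n → S) → S)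
    (hs : ∀ x, g *ᵥ (x - hermForm σ G y x • ys) = (x - hermForm σ G y x • ys) + s x • y) (x : n → S) :
    ((lineSwapGL σ (Matrix.fromBlocks G 0 0 (-G)) h2 : GL (n ⊕ n) S) : Matrix (n ⊕ n) (n ⊕ n) S) *ᵥ
      (Matrix.fromBlocks g 0 0 (1 : Matrix n n S) *ᵥ
        (((lineSwapGL σ (Matrix.fromBlocks G 0 0 (-G)) h2 : GL (n ⊕ n) S) : Matrix (n ⊕ n) (n ⊕ n) S) *ᵥ Sum.elim x x)) =
      Sum.elim (x + (s x + hermForm σ G y x * (α - 1)) • ys) (x + (s x + hermForm σ G y x * (α - 1)) • ys) := by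
  rw [lineSwapGL_mulVec_diag, fromBlocks_one_mulVec_graph hgy (hs x),
    lineSwapGL_mulVec_graph σ G h2 hyy hsy (hermForm_snd_lineSwap_diag_eq_zero σ G hys x)]
  funext i
  rcases i with i | i
  · simp only [Pi.add_apply, Pi.smul_apply, Pi.sub_apply, Sum.elim_inl, smul_eq_mul]; ring
  · simp only [Pi.add_apply, Pi.smul_apply, Pi.sub_apply, Sum.elim_inr, smul_eq_mul]; ring

omit [DecidableEq n] in
/-- the value `φ(y*) = α − 1` of the rank-one part at `y*` (`b(y*) = 0` since `h(y, y*) = 1`, hence `s(y*) = 0` when `s(x)•y` is the `Y`-defect of `g` on `b(x)` and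
`y ≠ 0`-free form: we state it with the defect hypothesis at `x = y*`). [cite: Kudla1994, §2] -/
theorem deltaBlock_coeff_at_partner (hys : hermForm σ G y ys = 1) {g : Matrix n n S} (s : (n → S) → S)
    (hs : g *ᵥ (ys - hermForm σ G y ys • ys) = (ys - hermForm σ G y ys • ys) + s ys • y) (hy : ∀ c : S, c • y = 0 → c = 0) {α : S} :
    s ys + hermForm σ G y ys * (α - 1) = α - 1 := by
  have hb : ys - hermForm σ G y ys • ys = 0 := by rw [hys, one_smul, sub_self]
  rw [hb, Matrix.mulVec_zero, zero_add] at hs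
  rw [hy (s ys) hs.symm, hys, zero_add, one_mul]

/-- `(1 + y* ⊗ r) x = x + (r·x) • y*` (rank-one perturbation of the identity, acting). [folklore] -/
theorem one_add_vecMulVec_mulVec (u r x : n → S) : (1 + Matrix.vecMulVec u r) *ᵥ x = x + (r ⬝ᵥ x) • u := by
  rw [Matrix.add_mulVec, Matrix.one_mulVec, Matrix.vecMulVec_mulVec, op_smul_eq_smul]

/-- `det (1 + y* ⊗ r) = 1 + r·y*` (Mathlib's `det_one_add_replicateCol_mul_replicateRow` in `vecMulVec` form). [folklore] -/
theorem det_one_add_vecMulVec (u r : n → S) : (1 + Matrix.vecMulVec u r).det = 1 + r ⬝ᵥ u := by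
  rw [Matrix.vecMulVec_eq (ι := Unit), Matrix.det_one_add_replicateCol_mul_replicateRow]

/-- **`det D = α`** for the `Δ`-block `D = 1 + y* ⊗ φ` of (D1″): if the row vector `r` represents `φ(x) = s(x) + h(y,x)(α − 1)` and `φ(y*) = α − 1`
(`deltaBlock_coeff_at_partner`), then `D x = x + φ(x) • y*` is the block of `swap_conj_blockOne_mulVec_diag` and `det D = α` — the scalar `det_Δ(w₀ (m(α) ⊕ 1) w₀) = α`
that (D2) feeds into Kudla's `P_Δ`-normalisation. [cite: Kudla1994, §2, Thm. 3.1] -/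
theorem det_deltaBlock_eq {r : n → S} (s : (n → S) → S) {α : S} (hr : ∀ x, r ⬝ᵥ x = s x + hermForm σ G y x * (α - 1))
    (hφ : s ys + hermForm σ G y ys * (α - 1) = α - 1) :
    (∀ x, (1 + Matrix.vecMulVec ys r) *ᵥ x = x + (s x + hermForm σ G y x * (α - 1)) • ys) ∧ (1 + Matrix.vecMulVec ys r).det = α := by
  refine ⟨fun x => by rw [one_add_vecMulVec_mulVec, hr], ?_⟩
  rw [det_one_add_vecMulVec, hr, hφ, add_sub_cancel]

end DeltaBlock

end Summit.HodgeConjecture.HodgeConjecture.Cruxes.H413.F0P2oDoubledGraphLagrangian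

end
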